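import Summits.CriticalPhenomena.PercolationContinuityZ3.Theorems.PercNearOneGluingNoHeavyLowerTailSahiLatinKernel

/-!
# `NoHeavyLowerTail` (crux stmt-CriticalPhenomena-4575), Sahi programme (prim-master-conj gen 42): the ORDER-4 LATIN KERNEL `K₄` of
# Sahi's fourth functional in EVERY dimension — definitions, particle re-indexing, `S₄` slot symmetry, and the LINK REDUCTION
# (the link of a point of `[4]^ι` is `[3]^ι`, Latin 4-tuples through a point are the Latin triples of its link)

Support file (`--supports stmt-CriticalPhenomena-4575`; order-4 companion of `…SahiLatinKernel`).  Memo
`run/shared/lean/prim/prim-l12/FROM-prim-master-conj-g41-DESCENT.md` §10 (paper), POINTWISE §42–§43.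

Sahi's `E₄` in set-partition form is `6E[abcd] − 2Σ₄E[abc]E[d] − Σ₃E[ab]E[cd] + Σ₆E[ab]E[c]E[d] − E[a]E[b]E[c]E[d]`
(`Literature…Sahi2008.sahiE_four`).  Reading the blocks on four independent copies and polarising along each axis (as for order 3,
`…SahiLatinBridge`) gives, on the grid `[4]^ι = ι → Fin 4`, the integer kernel
  `K₄(a,b,c,d) = Σ_{Latin 4-tuples (w,x,y,z)} G₄`,  `G₄ = [w∈a]·H₄^{bcd}(w,x,y,z)`
where a LATIN 4-TUPLE carries on every axis the four levels in some order (`ρ : ι → Perm (Fin 4)`, `lpt4 ρ j = fun i => ρ i j`) and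
we place the block containing `a` always on the first copy `w` (legitimate: Latin tuples are exchangeable), so that the co-factor
`H4 b c d w x y z` collects the other blocks (15 set partitions of `{a,b,c,d}`).
* `sum_lpt4_perm` (re-indexing by a permutation of the four copies) and the slot symmetries `kappa4_swap12/23/34` (hence full `S₄`);
* the LINK REDUCTION: `emb u q = fun i => (u i).succAbove (q i)` embeds `[3]^ι` monotonically onto the link of `u` (points differing
  from `u` in every coordinate); `red ρ : ι → Perm (Fin 3)` is the Latin triple of the link cut out by `ρ` (`lpt4_succ`:
  `ρ·(j+1) = emb (ρ·0) ((red ρ)·j)`; per axis `red1`, from the finite facts `exists_red`/`red_unique`/`exists_ext` by `decide`);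
  `sum_lperm4_eq_sum_link4` — **`Σ_ρ F(ρ·0,…,ρ·3) = Σ_u Σ_{σ : ι → Perm (Fin 3)} F(u, emb u (σ·0), emb u (σ·1), emb u (σ·2))`**;
* `pull4 u s` (the trace of `s` on the link, pulled back to `[3]^ι`; up-sets pull back to up-sets, `isUpperSet_pull4`), the order-4
  CHARGE `Phi4 b c d u = Σ_σ H₄(u, emb u(σ·0), emb u(σ·1), emb u(σ·2))` and the first-point form `kappa4_eq_sum_Phi4`, `kappa4_insert`,
  `kappa4_eq_kappa4_erase_add`.
The signs of `Phi4` (Lemma A₄ from FBP(3,|ι|) + T1 on the link, Lemma R₄ elementary), the order-4 descent and the `E₄` bridge are the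
companions `…SahiLatinMoves4/Descent4/Bridge4`.  Everything here is proved; axioms standard.
-/

namespace Summit.CriticalPhenomena.PercolationContinuityZ3.Theorems.SahiLatin

open Finset

variable {ι : Type*} [Fintype ι] [DecidableEq ι]

/-! ## Points of `[4]^ι`, Latin 4-tuples, the integrand and the kernel -/

/-- The grid `[4]^ι`. [this work] -/
abbrev Pt4 (ι : Type*) := ι → Fin 4

/-- Index set of the Latin 4-tuples: one permutation of the four levels per axis. [this work] -/
abbrev LPerm4 (ι : Type*) := ι → Equiv.Perm (Fin 4)

/-- The `j`-th point of the Latin 4-tuple indexed by `ρ`. [this work] -/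
def lpt4 (ρ : LPerm4 ι) (j : Fin 4) : Pt4 ι := fun i => ρ i j

/-- The co-factor of `[w ∈ a]` in the order-4 integrand: the 15 set partitions of `{a,b,c,d}` with Sahi's coefficients
`6, −2, −1, +1, −1`, the block of `a` on the copy `w`, the other blocks on `x, y, z`. [this work] -/
def H4 {β : Type*} [DecidableEq β] (b c d : Finset β) (w x y z : β) : ℤ :=
  6 * (ind b w * ind c w * ind d w)
  - 2 * (ind b w * ind c w * ind d x + ind b w * ind d w * ind c x + ind c w * ind d w * ind b x + ind b x * ind c x * ind d x)
  - (ind b w * (ind c x * ind d x) + ind c w * (ind b x * ind d x) + ind d w * (ind b x * ind c x))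
  + (ind b w * ind c x * ind d y + ind c w * ind b x * ind d y + ind d w * ind b x * ind c y
      + ind b x * ind c x * ind d y + ind b x * ind d x * ind c y + ind c x * ind d x * ind b y)
  - ind b x * ind c y * ind d z

/-- Sahi's order-4 integrand on four independent copies, `G₄ = [w∈a]·H₄^{bcd}(w,x,y,z)`. [this work] -/
def G4 {β : Type*} [DecidableEq β] (a b c d : Finset β) (w x y z : β) : ℤ := ind a w * H4 b c d w x y z

/-- **The order-4 Latin kernel** `K₄(a,b,c,d) = Σ_{Latin 4-tuples} G₄`. [this work] -/
def kappa4 (a b c d : Finset (Pt4 ι)) : ℤ := ∑ ρ : LPerm4 ι, G4 a b c d (lpt4 ρ 0) (lpt4 ρ 1) (lpt4 ρ 2) (lpt4 ρ 3)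

/-! ## Re-indexing by a permutation of the four copies; slot symmetry -/

/-- The constant family `i ↦ τ` in the group `LPerm4 ι`. [this work] -/
def cst4 (τ : Equiv.Perm (Fin 4)) : LPerm4 ι := fun _ => τ

omit [Fintype ι] [DecidableEq ι] in
/-- Points of `ρ · cst4 τ` are the `τ`-permuted points of `ρ`. [this work] -/
theorem lpt4_mul_cst4 (ρ : LPerm4 ι) (τ : Equiv.Perm (Fin 4)) (j : Fin 4) : lpt4 (ρ * cst4 τ) j = lpt4 ρ (τ j) := by
  funext i; simp [lpt4, cst4, Pi.mul_apply, Equiv.Perm.mul_apply]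

/-- Re-indexing an order-4 Latin sum by a permutation `τ` of the four copies. [this work] -/
theorem sum_lpt4_perm (F : Pt4 ι → Pt4 ι → Pt4 ι → Pt4 ι → ℤ) (τ : Equiv.Perm (Fin 4)) :
    ∑ ρ : LPerm4 ι, F (lpt4 ρ (τ 0)) (lpt4 ρ (τ 1)) (lpt4 ρ (τ 2)) (lpt4 ρ (τ 3)) =
      ∑ ρ : LPerm4 ι, F (lpt4 ρ 0) (lpt4 ρ 1) (lpt4 ρ 2) (lpt4 ρ 3) := by
  rw [← Equiv.sum_comp (Equiv.mulRight (cst4 (ι := ι) τ)) (fun ρ => F (lpt4 ρ 0) (lpt4 ρ 1) (lpt4 ρ 2) (lpt4 ρ 3))]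
  simp only [Equiv.coe_mulRight, lpt4_mul_cst4]

/-- Swapping copies `0` and `1`. [this work] -/
theorem sum_lpt4_swap01 (F : Pt4 ι → Pt4 ι → Pt4 ι → Pt4 ι → ℤ) :
    ∑ ρ : LPerm4 ι, F (lpt4 ρ 1) (lpt4 ρ 0) (lpt4 ρ 2) (lpt4 ρ 3) = ∑ ρ : LPerm4 ι, F (lpt4 ρ 0) (lpt4 ρ 1) (lpt4 ρ 2) (lpt4 ρ 3) := by
  have h := sum_lpt4_perm F (Equiv.swap 0 1)
  simpa [Equiv.swap_apply_left, Equiv.swap_apply_right, Equiv.swap_apply_of_ne_of_ne] using h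

/-- Swapping copies `0` and `2`. [this work] -/
theorem sum_lpt4_swap02 (F : Pt4 ι → Pt4 ι → Pt4 ι → Pt4 ι → ℤ) :
    ∑ ρ : LPerm4 ι, F (lpt4 ρ 2) (lpt4 ρ 1) (lpt4 ρ 0) (lpt4 ρ 3) = ∑ ρ : LPerm4 ι, F (lpt4 ρ 0) (lpt4 ρ 1) (lpt4 ρ 2) (lpt4 ρ 3) := by
  have h := sum_lpt4_perm F (Equiv.swap 0 2)
  simpa [Equiv.swap_apply_left, Equiv.swap_apply_right, Equiv.swap_apply_of_ne_of_ne] using h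

/-- Swapping copies `1` and `2`. [this work] -/
theorem sum_lpt4_swap12 (F : Pt4 ι → Pt4 ι → Pt4 ι → Pt4 ι → ℤ) :
    ∑ ρ : LPerm4 ι, F (lpt4 ρ 0) (lpt4 ρ 2) (lpt4 ρ 1) (lpt4 ρ 3) = ∑ ρ : LPerm4 ι, F (lpt4 ρ 0) (lpt4 ρ 1) (lpt4 ρ 2) (lpt4 ρ 3) := by
  have h := sum_lpt4_perm F (Equiv.swap 1 2)
  simpa [Equiv.swap_apply_left, Equiv.swap_apply_right, Equiv.swap_apply_of_ne_of_ne] using h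

/-- Swapping copies `2` and `3`. [this work] -/
theorem sum_lpt4_swap23 (F : Pt4 ι → Pt4 ι → Pt4 ι → Pt4 ι → ℤ) :
    ∑ ρ : LPerm4 ι, F (lpt4 ρ 0) (lpt4 ρ 1) (lpt4 ρ 3) (lpt4 ρ 2) = ∑ ρ : LPerm4 ι, F (lpt4 ρ 0) (lpt4 ρ 1) (lpt4 ρ 2) (lpt4 ρ 3) := by
  have h := sum_lpt4_perm F (Equiv.swap 2 3)
  simpa [Equiv.swap_apply_left, Equiv.swap_apply_right, Equiv.swap_apply_of_ne_of_ne] using h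

/-- A Latin sum of an antisymmetrised function under the swap of copies `0,1` vanishes. [this work] -/
theorem sum_sub_swap01_eq_zero (F : Pt4 ι → Pt4 ι → Pt4 ι → Pt4 ι → ℤ) :
    ∑ ρ : LPerm4 ι, (F (lpt4 ρ 0) (lpt4 ρ 1) (lpt4 ρ 2) (lpt4 ρ 3) - F (lpt4 ρ 1) (lpt4 ρ 0) (lpt4 ρ 2) (lpt4 ρ 3)) = 0 := by
  rw [sum_sub_distrib, sum_lpt4_swap01, sub_self]

/-- Same for the swap of copies `0,2`. [this work] -/
theorem sum_sub_swap02_eq_zero (F : Pt4 ι → Pt4 ι → Pt4 ι → Pt4 ι → ℤ) :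
    ∑ ρ : LPerm4 ι, (F (lpt4 ρ 0) (lpt4 ρ 1) (lpt4 ρ 2) (lpt4 ρ 3) - F (lpt4 ρ 2) (lpt4 ρ 1) (lpt4 ρ 0) (lpt4 ρ 3)) = 0 := by
  rw [sum_sub_distrib, sum_lpt4_swap02, sub_self]

/-- Same for the swap of copies `1,2`. [this work] -/
theorem sum_sub_swap12_eq_zero (F : Pt4 ι → Pt4 ι → Pt4 ι → Pt4 ι → ℤ) :
    ∑ ρ : LPerm4 ι, (F (lpt4 ρ 0) (lpt4 ρ 1) (lpt4 ρ 2) (lpt4 ρ 3) - F (lpt4 ρ 0) (lpt4 ρ 2) (lpt4 ρ 1) (lpt4 ρ 3)) = 0 := by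
  rw [sum_sub_distrib, sum_lpt4_swap12, sub_self]

/-- Same for the swap of copies `2,3`. [this work] -/
theorem sum_sub_swap23_eq_zero (F : Pt4 ι → Pt4 ι → Pt4 ι → Pt4 ι → ℤ) :
    ∑ ρ : LPerm4 ι, (F (lpt4 ρ 0) (lpt4 ρ 1) (lpt4 ρ 2) (lpt4 ρ 3) - F (lpt4 ρ 0) (lpt4 ρ 1) (lpt4 ρ 3) (lpt4 ρ 2)) = 0 := by
  rw [sum_sub_distrib, sum_lpt4_swap23, sub_self]

/-- `K₄` is symmetric in its second and third arguments. [this work] -/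
theorem kappa4_swap23 (a b c d : Finset (Pt4 ι)) : kappa4 a b c d = kappa4 a c b d := by
  have e : ∀ w x y z : Pt4 ι, G4 a b c d w x y z - G4 a c b d w x y z =
      (ind a w * ind d w * ind b x * ind c y - ind a w * ind b x * ind c y * ind d z)
        - (ind a w * ind d w * ind b y * ind c x - ind a w * ind b y * ind c x * ind d z) := fun w x y z => by
    simp only [G4, H4]; ring
  have h0 : kappa4 a b c d - kappa4 a c b d = 0 := by
    unfold kappa4
    rw [← sum_sub_distrib, sum_congr rfl (fun ρ _ => e _ _ _ _)]
    exact sum_sub_swap12_eq_zero (fun w x y z => ind a w * ind d w * ind b x * ind c y - ind a w * ind b x * ind c y * ind d z)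
  exact sub_eq_zero.mp h0

/-- `K₄` is symmetric in its last two arguments. [this work] -/
theorem kappa4_swap34 (a b c d : Finset (Pt4 ι)) : kappa4 a b c d = kappa4 a b d c := by
  have e : ∀ w x y z : Pt4 ι, G4 a b c d w x y z - G4 a b d c w x y z =
      ((ind a w * ind b w * ind c x * ind d y) - (ind a w * ind b w * ind c y * ind d x))
        + ((- (ind a w * ind b x * ind c y * ind d z)) - (-(ind a w * ind b x * ind c z * ind d y))) := fun w x y z => by
    simp only [G4, H4]; ring
  have h0 : kappa4 a b c d - kappa4 a b d c = 0 := by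
    unfold kappa4
    rw [← sum_sub_distrib, sum_congr rfl (fun ρ _ => e _ _ _ _), sum_add_distrib,
      sum_sub_swap12_eq_zero (fun w x y _ => ind a w * ind b w * ind c x * ind d y),
      sum_sub_swap23_eq_zero (fun w x y z => -(ind a w * ind b x * ind c y * ind d z)), add_zero]
  exact sub_eq_zero.mp h0

/-- `K₄` is symmetric in its first two arguments. [this work] -/
theorem kappa4_swap12 (a b c d : Finset (Pt4 ι)) : kappa4 a b c d = kappa4 b a c d := by
  -- nine of the fifteen partition terms move by the swap of copies `0,1`, one by the swap of copies `0,2`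
  have e : ∀ w x y z : Pt4 ι, G4 a b c d w x y z - G4 b a c d w x y z =
      ((-2 * (ind a w * ind c w * ind d w * ind b x) - 2 * (ind a w * (ind b x * ind c x * ind d x))
          - ind a w * ind c w * (ind b x * ind d x) - ind a w * ind d w * (ind b x * ind c x)
          + ind a w * ind c w * ind b x * ind d y + ind a w * ind d w * ind b x * ind c y
          + ind a w * (ind b x * ind c x) * ind d y + ind a w * (ind b x * ind d x) * ind c y
          - ind a w * ind b x * ind c y * ind d z)
        - (-2 * (ind a x * ind c x * ind d x * ind b w) - 2 * (ind a x * (ind b w * ind c w * ind d w))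
          - ind a x * ind c x * (ind b w * ind d w) - ind a x * ind d x * (ind b w * ind c w)
          + ind a x * ind c x * ind b w * ind d y + ind a x * ind d x * ind b w * ind c y
          + ind a x * (ind b w * ind c w) * ind d y + ind a x * (ind b w * ind d w) * ind c y
          - ind a x * ind b w * ind c y * ind d z))
      + ((ind a w * (ind c x * ind d x) * ind b y) - (ind a y * (ind c x * ind d x) * ind b w)) := fun w x y z => by
    simp only [G4, H4]; ring
  have h0 : kappa4 a b c d - kappa4 b a c d = 0 := by
    unfold kappa4
    rw [← sum_sub_distrib, sum_congr rfl (fun ρ _ => e _ _ _ _), sum_add_distrib,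
      sum_sub_swap01_eq_zero (fun w x y z => -2 * (ind a w * ind c w * ind d w * ind b x) - 2 * (ind a w * (ind b x * ind c x * ind d x))
          - ind a w * ind c w * (ind b x * ind d x) - ind a w * ind d w * (ind b x * ind c x)
          + ind a w * ind c w * ind b x * ind d y + ind a w * ind d w * ind b x * ind c y
          + ind a w * (ind b x * ind c x) * ind d y + ind a w * (ind b x * ind d x) * ind c y
          - ind a w * ind b x * ind c y * ind d z),
      sum_sub_swap02_eq_zero (fun w x y _ => ind a w * (ind c x * ind d x) * ind b y), add_zero]
  exact sub_eq_zero.mp h0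

/-- `K₄` is symmetric in its first and third arguments. [this work] -/
theorem kappa4_swap13 (a b c d : Finset (Pt4 ι)) : kappa4 a b c d = kappa4 c b a d := by
  rw [kappa4_swap12, kappa4_swap23, kappa4_swap12]

/-- `K₄` is symmetric in its first and fourth arguments. [this work] -/
theorem kappa4_swap14 (a b c d : Finset (Pt4 ι)) : kappa4 a b c d = kappa4 d b c a := by
  rw [kappa4_swap13, kappa4_swap34, kappa4_swap13]

/-! ## The link reduction: Latin 4-tuples through a point are the Latin triples of its link `≅ [3]^ι` -/

/-- Per axis: the three further values of a permutation of `Fin 4` are an order-relabelled permutation of `Fin 3`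
(finite check). [this work] -/
theorem exists_red : ∀ π : Equiv.Perm (Fin 4), ∃ σ : Equiv.Perm (Fin 3), ∀ j : Fin 3, π j.succ = (π 0).succAbove (σ j) := by
  decide

/-- … and that permutation of `Fin 3` is unique. [this work] -/
theorem red_unique (π : Equiv.Perm (Fin 4)) (σ τ : Equiv.Perm (Fin 3)) (hσ : ∀ j : Fin 3, π j.succ = (π 0).succAbove (σ j))
    (hτ : ∀ j : Fin 3, π j.succ = (π 0).succAbove (τ j)) : σ = τ := by
  ext j
  exact congrArg Fin.val (Fin.succAbove_right_injective ((hσ j).symm.trans (hτ j)))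

/-- Per axis: every (first value, permutation of `Fin 3`) comes from a permutation of `Fin 4` (finite check). [this work] -/
theorem exists_ext : ∀ (v : Fin 4) (σ : Equiv.Perm (Fin 3)), ∃ π : Equiv.Perm (Fin 4), π 0 = v ∧ ∀ j : Fin 3, π j.succ = v.succAbove (σ j) := by
  decide

/-- Per axis: the induced permutation of `Fin 3`. [this work] -/
noncomputable def red1 (π : Equiv.Perm (Fin 4)) : Equiv.Perm (Fin 3) :=
  Fintype.choose (fun σ : Equiv.Perm (Fin 3) => ∀ j : Fin 3, π j.succ = (π 0).succAbove (σ j))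
    ⟨(exists_red π).choose, (exists_red π).choose_spec, fun _ hτ => red_unique π _ _ hτ (exists_red π).choose_spec⟩

/-- Defining property of `red1`. [this work] -/
theorem red1_spec (π : Equiv.Perm (Fin 4)) (j : Fin 3) : π j.succ = (π 0).succAbove (red1 π j) :=
  Fintype.choose_spec (fun σ : Equiv.Perm (Fin 3) => ∀ j : Fin 3, π j.succ = (π 0).succAbove (σ j)) _ j

/-- The Latin triple of the link cut out by a Latin 4-tuple. [this work] -/
noncomputable def red (ρ : LPerm4 ι) : LPerm ι := fun i => red1 (ρ i)

/-- The monotone embedding of `[3]^ι` onto the link of `u` in `[4]^ι`: on axis `i`, skip the level `u i`. [this work] -/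
def emb (u : Pt4 ι) (q : Pt ι) : Pt4 ι := fun i => (u i).succAbove (q i)

omit [Fintype ι] [DecidableEq ι] in
/-- `emb u` is an order embedding. [this work] -/
theorem emb_le_iff {u : Pt4 ι} {q q' : Pt ι} : emb u q ≤ emb u q' ↔ q ≤ q' :=
  ⟨fun h i => Fin.succAbove_le_succAbove_iff.1 (h i), fun h i => Fin.succAbove_le_succAbove_iff.2 (h i)⟩

omit [Fintype ι] [DecidableEq ι] in
/-- `emb u` is injective. [this work] -/
theorem emb_injective (u : Pt4 ι) : Function.Injective (emb u) := fun _ _ h =>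
  le_antisymm (emb_le_iff.1 h.le) (emb_le_iff.1 h.ge)

omit [Fintype ι] [DecidableEq ι] in
/-- The later points of a Latin 4-tuple are the embedded points of the induced Latin triple. [this work] -/
theorem lpt4_succ (ρ : LPerm4 ι) (j : Fin 3) : lpt4 ρ j.succ = emb (lpt4 ρ 0) (lpt (red ρ) j) := by
  funext i; exact red1_spec (ρ i) j

/-- The map `ρ ↦ (ρ·0, red ρ)`. [this work] -/
noncomputable def quad (ρ : LPerm4 ι) : Pt4 ι × LPerm ι := (lpt4 ρ 0, red ρ)

omit [Fintype ι] [DecidableEq ι] in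
/-- `quad` is injective (a permutation of `Fin 4` is determined by its values). [this work] -/
theorem quad_injective : Function.Injective (quad (ι := ι)) := by
  intro ρ ρ' h
  simp only [quad, Prod.mk.injEq] at h
  funext i
  ext j
  refine Fin.cases ?_ (fun j' => ?_) j
  · exact congrArg Fin.val (congrFun h.1 i)
  · have e1 := red1_spec (ρ i) j'
    have e2 := red1_spec (ρ' i) j'
    have h0 : ρ i 0 = ρ' i 0 := congrFun h.1 i
    have hr : red1 (ρ i) = red1 (ρ' i) := congrFun h.2 i
    rw [e1, e2, h0, hr]

omit [Fintype ι] [DecidableEq ι] in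
/-- `quad` is surjective. [this work] -/
theorem quad_surjective : Function.Surjective (quad (ι := ι)) := by
  rintro ⟨u, σ⟩
  choose π hπ using fun i => exists_ext (u i) (σ i)
  refine ⟨π, ?_⟩
  have h0 : lpt4 π 0 = u := funext fun i => (hπ i).1
  have hr : red π = σ := by
    funext i
    refine red_unique (π i) _ _ (red1_spec (π i)) fun j => ?_
    rw [(hπ i).1]; exact (hπ i).2 j
  simp only [quad, h0, hr]

/-- `quad` as a bijection. [this work] -/
noncomputable def quadEquiv : LPerm4 ι ≃ Pt4 ι × LPerm ι := Equiv.ofBijective quad ⟨quad_injective, quad_surjective⟩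

/-- **Link reduction of an order-4 Latin sum**:
`Σ_ρ F(ρ·0, ρ·1, ρ·2, ρ·3) = Σ_u Σ_σ F(u, emb u (σ·0), emb u (σ·1), emb u (σ·2))`. [this work] -/
theorem sum_lperm4_eq_sum_link4 (F : Pt4 ι → Pt4 ι → Pt4 ι → Pt4 ι → ℤ) :
    ∑ ρ : LPerm4 ι, F (lpt4 ρ 0) (lpt4 ρ 1) (lpt4 ρ 2) (lpt4 ρ 3) =
      ∑ u : Pt4 ι, ∑ σ : LPerm ι, F u (emb u (lpt σ 0)) (emb u (lpt σ 1)) (emb u (lpt σ 2)) := by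
  have h1 : ∀ ρ : LPerm4 ι, F (lpt4 ρ 0) (lpt4 ρ 1) (lpt4 ρ 2) (lpt4 ρ 3) =
      (fun p : Pt4 ι × LPerm ι => F p.1 (emb p.1 (lpt p.2 0)) (emb p.1 (lpt p.2 1)) (emb p.1 (lpt p.2 2))) (quadEquiv ρ) := by
    intro ρ
    have e1 : lpt4 ρ 1 = emb (lpt4 ρ 0) (lpt (red ρ) 0) := lpt4_succ ρ 0
    have e2 : lpt4 ρ 2 = emb (lpt4 ρ 0) (lpt (red ρ) 1) := lpt4_succ ρ 1
    have e3 : lpt4 ρ 3 = emb (lpt4 ρ 0) (lpt (red ρ) 2) := lpt4_succ ρ 2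
    rw [e1, e2, e3]; rfl
  rw [sum_congr rfl (fun ρ _ => h1 ρ), Equiv.sum_comp quadEquiv
    (fun p : Pt4 ι × LPerm ι => F p.1 (emb p.1 (lpt p.2 0)) (emb p.1 (lpt p.2 1)) (emb p.1 (lpt p.2 2))), Fintype.sum_prod_type]

/-! ## Pulled-back traces, the order-4 charge and the first-point form -/

/-- The trace of `s ⊆ [4]^ι` on the link of `u`, pulled back to `[3]^ι`. [this work] -/
def pull4 (u : Pt4 ι) (s : Finset (Pt4 ι)) : Finset (Pt ι) := univ.filter fun q => emb u q ∈ s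

/-- Membership in the pulled-back trace. [this work] -/
@[simp] theorem mem_pull4 {u : Pt4 ι} {s : Finset (Pt4 ι)} {q : Pt ι} : q ∈ pull4 u s ↔ emb u q ∈ s := by
  simp [pull4]

/-- Indicators pull back. [this work] -/
theorem ind_emb (u : Pt4 ι) (s : Finset (Pt4 ι)) (q : Pt ι) : ind s (emb u q) = ind (pull4 u s) q := by
  by_cases h : emb u q ∈ s
  · rw [ind_of_mem h, ind_of_mem (mem_pull4.2 h)]
  · rw [ind_of_not_mem h, ind_of_not_mem (fun h' => h (mem_pull4.1 h'))]

/-- Pull-backs commute with intersection. [this work] -/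
theorem pull4_inter (u : Pt4 ι) (s t : Finset (Pt4 ι)) : pull4 u (s ∩ t) = pull4 u s ∩ pull4 u t := by
  ext q; simp [pull4]

/-- The pulled-back trace of an up-set is an up-set of `[3]^ι`. [this work] -/
theorem isUpperSet_pull4 (u : Pt4 ι) {s : Finset (Pt4 ι)} (hs : IsUpperSet (s : Set (Pt4 ι))) :
    IsUpperSet ((pull4 u s : Finset (Pt ι)) : Set (Pt ι)) := by
  intro q q' hqq' hq
  rw [Finset.mem_coe, mem_pull4] at hq ⊢
  exact hs (emb_le_iff.2 hqq') hq

/-- The order-4 CHARGE `Φ⁴_{bcd}(u)`: the coefficient of `[u ∈ a]` in `K₄(a,b,c,d)`, a Latin sum over the link of `u`. [this work] -/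
noncomputable def Phi4 (b c d : Finset (Pt4 ι)) (u : Pt4 ι) : ℤ :=
  ∑ σ : LPerm ι, H4 b c d u (emb u (lpt σ 0)) (emb u (lpt σ 1)) (emb u (lpt σ 2))

/-- **First-point form** of the order-4 kernel: `K₄(a,b,c,d) = Σ_{u ∈ a} Φ⁴_{bcd}(u)`. [this work] -/
theorem kappa4_eq_sum_Phi4 (a b c d : Finset (Pt4 ι)) : kappa4 a b c d = ∑ u ∈ a, Phi4 b c d u := by
  unfold kappa4
  simp only [G4]
  rw [sum_lperm4_eq_sum_link4 (fun w x y z => ind a w * H4 b c d w x y z)]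
  rw [← sum_filter_add_sum_filter_not univ (fun u => u ∈ a)]
  have hin : ∑ u ∈ univ.filter (fun u => u ∈ a), ∑ σ : LPerm ι, ind a u * H4 b c d u (emb u (lpt σ 0)) (emb u (lpt σ 1)) (emb u (lpt σ 2))
      = ∑ u ∈ a, Phi4 b c d u := by
    rw [filter_univ_mem]
    refine sum_congr rfl fun u hu => ?_
    simp only [ind_of_mem hu, one_mul, Phi4]
  have hout : ∑ u ∈ univ.filter (fun u => ¬ u ∈ a), ∑ σ : LPerm ι, ind a u * H4 b c d u (emb u (lpt σ 0)) (emb u (lpt σ 1))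
      (emb u (lpt σ 2)) = 0 :=
    sum_eq_zero fun u hu => by
      rw [mem_filter] at hu
      simp [ind_of_not_mem hu.2]
  rw [hin, hout, add_zero]

/-- Adding a point `m ∉ a` changes `K₄` by the charge `Φ⁴_{bcd}(m)`. [this work] -/
theorem kappa4_insert {a : Finset (Pt4 ι)} {m : Pt4 ι} (hm : m ∉ a) (b c d : Finset (Pt4 ι)) :
    kappa4 (insert m a) b c d = kappa4 a b c d + Phi4 b c d m := by
  rw [kappa4_eq_sum_Phi4, kappa4_eq_sum_Phi4, sum_insert hm, add_comm]

/-- `K₄(a) = K₄(a ∖ {m}) + Φ⁴_{bcd}(m)` for `m ∈ a`. [this work] -/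
theorem kappa4_eq_kappa4_erase_add {a : Finset (Pt4 ι)} {m : Pt4 ι} (hm : m ∈ a) (b c d : Finset (Pt4 ι)) :
    kappa4 a b c d = kappa4 (a.erase m) b c d + Phi4 b c d m := by
  conv_lhs => rw [← insert_erase hm]
  exact kappa4_insert (notMem_erase m a) b c d

end Summit.CriticalPhenomena.PercolationContinuityZ3.Theorems.SahiLatin
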